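import Summits.Ventures.CertifiedArithmetic.LowPrec.GemmThetaLawE3M2FamilyTraj
import Summits.Ventures.CertifiedArithmetic.LowPrec.GemmTwoBinadeClimb
import HarnessLib

/-!
# GEMM worst case LIX-c — the canonical E3M2·E3M2 family for EVERY precision `p ≥ 16`: the
# accumulator follows `traj8` along the whole prefix (`507905K + 2` roundings, one binade step
# each)

HONEST FRAMING: certified error envelopes and provably optimal rounding/accumulation schemes for
low-precision formats under stated cost models; every table by two implementations; no hardware or
vendor claims.

For a format `φ` with `qexp φ ≤ -8`, `2^(manBits φ + 20) ≤ maxRat φ` and `2^manBits = 32768K`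
(`K = 2^(p-16)`), the family `fam8 K` of file LIX-a (`GemmThetaLawE3M2FamilyWord`; every letter
a product of two E3M2 data) has the explicit accumulator trajectory `traj8 K` (`fam8_seqSum`):
exact sums up to `2·2^manBits` grid units, every `3/256` is `spacing + tie` resolved up, in
binade `j = 1..15` each letter of the pair `(x_j, 2^j)/256` advances the accumulator by exactly
one grid step (`x_j` exceeds the half-spacing from an even point, `2^j` is a tie from an odd
point resolved up), and the end pair `(280, 256)` makes two more steps to `v° = (32768K+2)·512`
(value `2^(p+8) + 2^10`).  Method: the binade-step lemma `rneSigMag_binade_step` (file XLIX-a),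
the grid bridge `value_step8`, a nineteen-way case analysis of the letter index closed by
`omega` (`traj8_step`; no `decide` — the precision is a symbol).  Sequel
`GemmThetaLawE3M2Family`: the absorbed tail and the exact relative error.
References: [Higham2002, §4.2], [MullerEtAl2018HFPA, §6.1], [BoldoMelquiond2011Flocq].
-/

namespace Summit.Ventures.CertifiedArithmetic.LowPrec.Gemm

open Literature.ComputerArithmetic.FloatingPoint
open Literature.ComputerArithmetic.FloatingPoint.MiniFloat
open Literature.ComputerArithmetic.FloatingPoint.MiniFloat.TieChain (seqSum_orbitFn)
open Finset

variable {φ : Format}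

section Steps

variable (hq : φ.qexp ≤ -8) (hR : (2 : ℚ) ^ (φ.manBits + 20) ≤ φ.maxRat)
  {K : ℕ} (hM : 2 ^ φ.manBits = 32768 * K)
include hq hR hM

/-- THE PREFIX ROUNDINGS (nineteen cases of the letter index, each one binade step):
`fl_φ(traj8 k + fam8 (k+1)) = traj8 (k+1)` for every `k ≤ 507905K`, and the step is in range.
[cell] -/
theorem traj8_step (k : ℕ) (hk : k < 507905 * K + 1) :
    (roundNE φ (traj8 K k + fam8 K (k + 1))).toRat = traj8 K (k + 1) ∧
      |traj8 K k + fam8 K (k + 1)| ≤ φ.maxRat := by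
  obtain ⟨hK1, hpow, hpow1⟩ := pow_facts8 hM
  have h2 : 2 ∣ 32768 * K := ⟨16384 * K, by ring⟩
  unfold traj8 fam8
  rcases (by omega : k + 2 < K ∨ k + 2 = K ∨ (K ≤ k + 1 ∧ k + 2 ≤ 16385 * K) ∨
      (16385 * K ≤ k + 1 ∧ k + 2 ≤ 49153 * K) ∨ (49153 * K ≤ k + 1 ∧ k + 2 ≤ 81921 * K) ∨
      (81921 * K ≤ k + 1 ∧ k + 2 ≤ 114689 * K) ∨ (114689 * K ≤ k + 1 ∧ k + 2 ≤ 147457 * K) ∨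
      (147457 * K ≤ k + 1 ∧ k + 2 ≤ 180225 * K) ∨ (180225 * K ≤ k + 1 ∧ k + 2 ≤ 212993 * K) ∨
      (212993 * K ≤ k + 1 ∧ k + 2 ≤ 245761 * K) ∨ (245761 * K ≤ k + 1 ∧ k + 2 ≤ 278529 * K) ∨
      (278529 * K ≤ k + 1 ∧ k + 2 ≤ 311297 * K) ∨ (311297 * K ≤ k + 1 ∧ k + 2 ≤ 344065 * K) ∨
      (344065 * K ≤ k + 1 ∧ k + 2 ≤ 376833 * K) ∨ (376833 * K ≤ k + 1 ∧ k + 2 ≤ 409601 * K) ∨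
      (409601 * K ≤ k + 1 ∧ k + 2 ≤ 442369 * K) ∨ (442369 * K ≤ k + 1 ∧ k + 2 ≤ 475137 * K) ∨
      (475137 * K ≤ k + 1 ∧ k + 2 ≤ 507905 * K) ∨
      (507905 * K ≤ k + 1 ∧ k + 2 ≤ 507905 * K + 2)) with
      h | h | h | h | h | h | h | h | h | h | h | h | h | h | h | h | h | h | h
  · -- exact prefix: `65536(k+2) < 65536K = 2^(m+1)`
    refine value_step8 hq hR (n := 65536 * k + 131072) ?_ (by omega) ?_
    · rw [traj8N_P (by omega), fam8Z_P (by omega)]; push_cast; omega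
    · rw [traj8N_P (by omega), rneSigMag_of_lt (by rw [hpow1]; omega)]; omega
  · -- the last `256` lands exactly on `2^(m+1) = (32768K + 0)·2 + 0` (binade 0, `r = 0`)
    refine value_step8 hq hR (n := (32768 * K + 0) * 2 + 0) ?_ (by omega) ?_
    · rw [traj8N_P (by omega), fam8Z_P (by omega)]; push_cast; omega
    · rw [traj8N_P (by omega), rneSigMag_binade_step (j := 0) hM h2 (by norm_num) (by omega)
        (by norm_num)]
      simp [stepUp]; omega
  · -- binade 0, letter `3 = spacing + 1` from an even point: a tie at an odd `t`, resolved up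
    refine value_step8 hq hR (n := (32768 * K + (2 * k + 3 - 2 * K)) * 2 + 1) ?_ (by omega) ?_
    · rw [traj8N_B0 (by omega) (by omega), fam8Z_B0 (by omega) (by omega)]; push_cast; omega
    · rw [traj8N_B0 (by omega) (by omega), rneSigMag_binade_step (j := 0) hM h2 (by norm_num)
        (by omega) (by norm_num)]
      simp [stepUp]; omega
  · obtain ⟨e, he, hek⟩ : ∃ e, e < 32768 * K ∧ k + 1 = 16385 * K + e :=  -- binade 1
      ⟨k + 1 - 16385 * K, by omega, by omega⟩
    rcases Nat.mod_two_eq_zero_or_one e with hp | hp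
    · refine value_step8 hq hR (n := (32768 * K + e) * 4 + 3) ?_ (by omega) ?_
      · rw [traj8N_T1 (by omega) (by omega), hek, fam8Z_B1 K e he, pairZ_even _ _ hp]
        push_cast; omega
      · rw [traj8N_T1 (by omega) (by omega), rneSigMag_binade_step (j := 1) hM h2 (by norm_num)
          (by omega) (by norm_num)]
        simp [stepUp]; omega
    · refine value_step8 hq hR (n := (32768 * K + e) * 4 + 2) ?_ (by omega) ?_
      · rw [traj8N_T1 (by omega) (by omega), hek, fam8Z_B1 K e he, pairZ_odd _ _ hp]
        push_cast; omega
      · rw [traj8N_T1 (by omega) (by omega), rneSigMag_binade_step (j := 1) hM h2 (by norm_num)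
          (by omega) (by norm_num)]
        simp [stepUp]; omega
  · obtain ⟨e, he, hek⟩ : ∃ e, e < 32768 * K ∧ k + 1 = 49153 * K + e :=  -- binade 2
      ⟨k + 1 - 49153 * K, by omega, by omega⟩
    rcases Nat.mod_two_eq_zero_or_one e with hp | hp
    · refine value_step8 hq hR (n := (32768 * K + e) * 8 + 5) ?_ (by omega) ?_
      · rw [traj8N_T2 (by omega) (by omega), hek, fam8Z_B2 K e he, pairZ_even _ _ hp]
        push_cast; omega
      · rw [traj8N_T2 (by omega) (by omega), rneSigMag_binade_step (j := 2) hM h2 (by norm_num)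
          (by omega) (by norm_num)]
        simp [stepUp]; omega
    · refine value_step8 hq hR (n := (32768 * K + e) * 8 + 4) ?_ (by omega) ?_
      · rw [traj8N_T2 (by omega) (by omega), hek, fam8Z_B2 K e he, pairZ_odd _ _ hp]
        push_cast; omega
      · rw [traj8N_T2 (by omega) (by omega), rneSigMag_binade_step (j := 2) hM h2 (by norm_num)
          (by omega) (by norm_num)]
        simp [stepUp]; omega
  · obtain ⟨e, he, hek⟩ : ∃ e, e < 32768 * K ∧ k + 1 = 81921 * K + e :=  -- binade 3
      ⟨k + 1 - 81921 * K, by omega, by omega⟩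
    rcases Nat.mod_two_eq_zero_or_one e with hp | hp
    · refine value_step8 hq hR (n := (32768 * K + e) * 16 + 9) ?_ (by omega) ?_
      · rw [traj8N_T3 (by omega) (by omega), hek, fam8Z_B3 K e he, pairZ_even _ _ hp]
        push_cast; omega
      · rw [traj8N_T3 (by omega) (by omega), rneSigMag_binade_step (j := 3) hM h2 (by norm_num)
          (by omega) (by norm_num)]
        simp [stepUp]; omega
    · refine value_step8 hq hR (n := (32768 * K + e) * 16 + 8) ?_ (by omega) ?_
      · rw [traj8N_T3 (by omega) (by omega), hek, fam8Z_B3 K e he, pairZ_odd _ _ hp]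
        push_cast; omega
      · rw [traj8N_T3 (by omega) (by omega), rneSigMag_binade_step (j := 3) hM h2 (by norm_num)
          (by omega) (by norm_num)]
        simp [stepUp]; omega
  · obtain ⟨e, he, hek⟩ : ∃ e, e < 32768 * K ∧ k + 1 = 114689 * K + e :=  -- binade 4
      ⟨k + 1 - 114689 * K, by omega, by omega⟩
    rcases Nat.mod_two_eq_zero_or_one e with hp | hp
    · refine value_step8 hq hR (n := (32768 * K + e) * 32 + 18) ?_ (by omega) ?_
      · rw [traj8N_T4 (by omega) (by omega), hek, fam8Z_B4 K e he, pairZ_even _ _ hp]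
        push_cast; omega
      · rw [traj8N_T4 (by omega) (by omega), rneSigMag_binade_step (j := 4) hM h2 (by norm_num)
          (by omega) (by norm_num)]
        simp [stepUp]; omega
    · refine value_step8 hq hR (n := (32768 * K + e) * 32 + 16) ?_ (by omega) ?_
      · rw [traj8N_T4 (by omega) (by omega), hek, fam8Z_B4 K e he, pairZ_odd _ _ hp]
        push_cast; omega
      · rw [traj8N_T4 (by omega) (by omega), rneSigMag_binade_step (j := 4) hM h2 (by norm_num)
          (by omega) (by norm_num)]
        simp [stepUp]; omega
  · obtain ⟨e, he, hek⟩ : ∃ e, e < 32768 * K ∧ k + 1 = 147457 * K + e :=  -- binade 5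
      ⟨k + 1 - 147457 * K, by omega, by omega⟩
    rcases Nat.mod_two_eq_zero_or_one e with hp | hp
    · refine value_step8 hq hR (n := (32768 * K + e) * 64 + 35) ?_ (by omega) ?_
      · rw [traj8N_T5 (by omega) (by omega), hek, fam8Z_B5 K e he, pairZ_even _ _ hp]
        push_cast; omega
      · rw [traj8N_T5 (by omega) (by omega), rneSigMag_binade_step (j := 5) hM h2 (by norm_num)
          (by omega) (by norm_num)]
        simp [stepUp]; omega
    · refine value_step8 hq hR (n := (32768 * K + e) * 64 + 32) ?_ (by omega) ?_
      · rw [traj8N_T5 (by omega) (by omega), hek, fam8Z_B5 K e he, pairZ_odd _ _ hp]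
        push_cast; omega
      · rw [traj8N_T5 (by omega) (by omega), rneSigMag_binade_step (j := 5) hM h2 (by norm_num)
          (by omega) (by norm_num)]
        simp [stepUp]; omega
  · obtain ⟨e, he, hek⟩ : ∃ e, e < 32768 * K ∧ k + 1 = 180225 * K + e :=  -- binade 6
      ⟨k + 1 - 180225 * K, by omega, by omega⟩
    rcases Nat.mod_two_eq_zero_or_one e with hp | hp
    · refine value_step8 hq hR (n := (32768 * K + e) * 128 + 70) ?_ (by omega) ?_
      · rw [traj8N_T6 (by omega) (by omega), hek, fam8Z_B6 K e he, pairZ_even _ _ hp]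
        push_cast; omega
      · rw [traj8N_T6 (by omega) (by omega), rneSigMag_binade_step (j := 6) hM h2 (by norm_num)
          (by omega) (by norm_num)]
        simp [stepUp]; omega
    · refine value_step8 hq hR (n := (32768 * K + e) * 128 + 64) ?_ (by omega) ?_
      · rw [traj8N_T6 (by omega) (by omega), hek, fam8Z_B6 K e he, pairZ_odd _ _ hp]
        push_cast; omega
      · rw [traj8N_T6 (by omega) (by omega), rneSigMag_binade_step (j := 6) hM h2 (by norm_num)
          (by omega) (by norm_num)]
        simp [stepUp]; omega
  · obtain ⟨e, he, hek⟩ : ∃ e, e < 32768 * K ∧ k + 1 = 212993 * K + e :=  -- binade 7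
      ⟨k + 1 - 212993 * K, by omega, by omega⟩
    rcases Nat.mod_two_eq_zero_or_one e with hp | hp
    · refine value_step8 hq hR (n := (32768 * K + e) * 256 + 140) ?_ (by omega) ?_
      · rw [traj8N_T7 (by omega) (by omega), hek, fam8Z_B7 K e he, pairZ_even _ _ hp]
        push_cast; omega
      · rw [traj8N_T7 (by omega) (by omega), rneSigMag_binade_step (j := 7) hM h2 (by norm_num)
          (by omega) (by norm_num)]
        simp [stepUp]; omega
    · refine value_step8 hq hR (n := (32768 * K + e) * 256 + 128) ?_ (by omega) ?_
      · rw [traj8N_T7 (by omega) (by omega), hek, fam8Z_B7 K e he, pairZ_odd _ _ hp]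
        push_cast; omega
      · rw [traj8N_T7 (by omega) (by omega), rneSigMag_binade_step (j := 7) hM h2 (by norm_num)
          (by omega) (by norm_num)]
        simp [stepUp]; omega
  · obtain ⟨e, he, hek⟩ : ∃ e, e < 32768 * K ∧ k + 1 = 245761 * K + e :=  -- binade 8
      ⟨k + 1 - 245761 * K, by omega, by omega⟩
    rcases Nat.mod_two_eq_zero_or_one e with hp | hp
    · refine value_step8 hq hR (n := (32768 * K + e) * 512 + 280) ?_ (by omega) ?_
      · rw [traj8N_T8 (by omega) (by omega), hek, fam8Z_B8 K e he, pairZ_even _ _ hp]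
        push_cast; omega
      · rw [traj8N_T8 (by omega) (by omega), rneSigMag_binade_step (j := 8) hM h2 (by norm_num)
          (by omega) (by norm_num)]
        simp [stepUp]; omega
    · refine value_step8 hq hR (n := (32768 * K + e) * 512 + 256) ?_ (by omega) ?_
      · rw [traj8N_T8 (by omega) (by omega), hek, fam8Z_B8 K e he, pairZ_odd _ _ hp]
        push_cast; omega
      · rw [traj8N_T8 (by omega) (by omega), rneSigMag_binade_step (j := 8) hM h2 (by norm_num)
          (by omega) (by norm_num)]
        simp [stepUp]; omega
  · obtain ⟨e, he, hek⟩ : ∃ e, e < 32768 * K ∧ k + 1 = 278529 * K + e :=  -- binade 9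
      ⟨k + 1 - 278529 * K, by omega, by omega⟩
    rcases Nat.mod_two_eq_zero_or_one e with hp | hp
    · refine value_step8 hq hR (n := (32768 * K + e) * 1024 + 560) ?_ (by omega) ?_
      · rw [traj8N_T9 (by omega) (by omega), hek, fam8Z_B9 K e he, pairZ_even _ _ hp]
        push_cast; omega
      · rw [traj8N_T9 (by omega) (by omega), rneSigMag_binade_step (j := 9) hM h2 (by norm_num)
          (by omega) (by norm_num)]
        simp [stepUp]; omega
    · refine value_step8 hq hR (n := (32768 * K + e) * 1024 + 512) ?_ (by omega) ?_
      · rw [traj8N_T9 (by omega) (by omega), hek, fam8Z_B9 K e he, pairZ_odd _ _ hp]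
        push_cast; omega
      · rw [traj8N_T9 (by omega) (by omega), rneSigMag_binade_step (j := 9) hM h2 (by norm_num)
          (by omega) (by norm_num)]
        simp [stepUp]; omega
  · obtain ⟨e, he, hek⟩ : ∃ e, e < 32768 * K ∧ k + 1 = 311297 * K + e :=  -- binade 10
      ⟨k + 1 - 311297 * K, by omega, by omega⟩
    rcases Nat.mod_two_eq_zero_or_one e with hp | hp
    · refine value_step8 hq hR (n := (32768 * K + e) * 2048 + 1120) ?_ (by omega) ?_
      · rw [traj8N_T10 (by omega) (by omega), hek, fam8Z_B10 K e he, pairZ_even _ _ hp]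
        push_cast; omega
      · rw [traj8N_T10 (by omega) (by omega), rneSigMag_binade_step (j := 10) hM h2 (by norm_num)
          (by omega) (by norm_num)]
        simp [stepUp]; omega
    · refine value_step8 hq hR (n := (32768 * K + e) * 2048 + 1024) ?_ (by omega) ?_
      · rw [traj8N_T10 (by omega) (by omega), hek, fam8Z_B10 K e he, pairZ_odd _ _ hp]
        push_cast; omega
      · rw [traj8N_T10 (by omega) (by omega), rneSigMag_binade_step (j := 10) hM h2 (by norm_num)
          (by omega) (by norm_num)]
        simp [stepUp]; omega
  · obtain ⟨e, he, hek⟩ : ∃ e, e < 32768 * K ∧ k + 1 = 344065 * K + e :=  -- binade 11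
      ⟨k + 1 - 344065 * K, by omega, by omega⟩
    rcases Nat.mod_two_eq_zero_or_one e with hp | hp
    · refine value_step8 hq hR (n := (32768 * K + e) * 4096 + 2240) ?_ (by omega) ?_
      · rw [traj8N_T11 (by omega) (by omega), hek, fam8Z_B11 K e he, pairZ_even _ _ hp]
        push_cast; omega
      · rw [traj8N_T11 (by omega) (by omega), rneSigMag_binade_step (j := 11) hM h2 (by norm_num)
          (by omega) (by norm_num)]
        simp [stepUp]; omega
    · refine value_step8 hq hR (n := (32768 * K + e) * 4096 + 2048) ?_ (by omega) ?_
      · rw [traj8N_T11 (by omega) (by omega), hek, fam8Z_B11 K e he, pairZ_odd _ _ hp]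
        push_cast; omega
      · rw [traj8N_T11 (by omega) (by omega), rneSigMag_binade_step (j := 11) hM h2 (by norm_num)
          (by omega) (by norm_num)]
        simp [stepUp]; omega
  · obtain ⟨e, he, hek⟩ : ∃ e, e < 32768 * K ∧ k + 1 = 376833 * K + e :=  -- binade 12
      ⟨k + 1 - 376833 * K, by omega, by omega⟩
    rcases Nat.mod_two_eq_zero_or_one e with hp | hp
    · refine value_step8 hq hR (n := (32768 * K + e) * 8192 + 4480) ?_ (by omega) ?_
      · rw [traj8N_T12 (by omega) (by omega), hek, fam8Z_B12 K e he, pairZ_even _ _ hp]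
        push_cast; omega
      · rw [traj8N_T12 (by omega) (by omega), rneSigMag_binade_step (j := 12) hM h2 (by norm_num)
          (by omega) (by norm_num)]
        simp [stepUp]; omega
    · refine value_step8 hq hR (n := (32768 * K + e) * 8192 + 4096) ?_ (by omega) ?_
      · rw [traj8N_T12 (by omega) (by omega), hek, fam8Z_B12 K e he, pairZ_odd _ _ hp]
        push_cast; omega
      · rw [traj8N_T12 (by omega) (by omega), rneSigMag_binade_step (j := 12) hM h2 (by norm_num)
          (by omega) (by norm_num)]
        simp [stepUp]; omega
  · obtain ⟨e, he, hek⟩ : ∃ e, e < 32768 * K ∧ k + 1 = 409601 * K + e :=  -- binade 13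
      ⟨k + 1 - 409601 * K, by omega, by omega⟩
    rcases Nat.mod_two_eq_zero_or_one e with hp | hp
    · refine value_step8 hq hR (n := (32768 * K + e) * 16384 + 8960) ?_ (by omega) ?_
      · rw [traj8N_T13 (by omega) (by omega), hek, fam8Z_B13 K e he, pairZ_even _ _ hp]
        push_cast; omega
      · rw [traj8N_T13 (by omega) (by omega), rneSigMag_binade_step (j := 13) hM h2 (by norm_num)
          (by omega) (by norm_num)]
        simp [stepUp]; omega
    · refine value_step8 hq hR (n := (32768 * K + e) * 16384 + 8192) ?_ (by omega) ?_
      · rw [traj8N_T13 (by omega) (by omega), hek, fam8Z_B13 K e he, pairZ_odd _ _ hp]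
        push_cast; omega
      · rw [traj8N_T13 (by omega) (by omega), rneSigMag_binade_step (j := 13) hM h2 (by norm_num)
          (by omega) (by norm_num)]
        simp [stepUp]; omega
  · obtain ⟨e, he, hek⟩ : ∃ e, e < 32768 * K ∧ k + 1 = 442369 * K + e :=  -- binade 14
      ⟨k + 1 - 442369 * K, by omega, by omega⟩
    rcases Nat.mod_two_eq_zero_or_one e with hp | hp
    · refine value_step8 hq hR (n := (32768 * K + e) * 32768 + 17920) ?_ (by omega) ?_
      · rw [traj8N_T14 (by omega) (by omega), hek, fam8Z_B14 K e he, pairZ_even _ _ hp]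
        push_cast; omega
      · rw [traj8N_T14 (by omega) (by omega), rneSigMag_binade_step (j := 14) hM h2 (by norm_num)
          (by omega) (by norm_num)]
        simp [stepUp]; omega
    · refine value_step8 hq hR (n := (32768 * K + e) * 32768 + 16384) ?_ (by omega) ?_
      · rw [traj8N_T14 (by omega) (by omega), hek, fam8Z_B14 K e he, pairZ_odd _ _ hp]
        push_cast; omega
      · rw [traj8N_T14 (by omega) (by omega), rneSigMag_binade_step (j := 14) hM h2 (by norm_num)
          (by omega) (by norm_num)]
        simp [stepUp]; omega
  · obtain ⟨e, he, hek⟩ : ∃ e, e < 32768 * K ∧ k + 1 = 475137 * K + e :=  -- binade 15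
      ⟨k + 1 - 475137 * K, by omega, by omega⟩
    rcases Nat.mod_two_eq_zero_or_one e with hp | hp
    · refine value_step8 hq hR (n := (32768 * K + e) * 65536 + 35840) ?_ (by omega) ?_
      · rw [traj8N_T15 (by omega) (by omega), hek, fam8Z_B15 K e he, pairZ_even _ _ hp]
        push_cast; omega
      · rw [traj8N_T15 (by omega) (by omega), rneSigMag_binade_step (j := 15) hM h2 (by norm_num)
          (by omega) (by norm_num)]
        simp [stepUp]; omega
    · refine value_step8 hq hR (n := (32768 * K + e) * 65536 + 32768) ?_ (by omega) ?_
      · rw [traj8N_T15 (by omega) (by omega), hek, fam8Z_B15 K e he, pairZ_odd _ _ hp]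
        push_cast; omega
      · rw [traj8N_T15 (by omega) (by omega), rneSigMag_binade_step (j := 15) hM h2 (by norm_num)
          (by omega) (by norm_num)]
        simp [stepUp]; omega
  · obtain ⟨e, he, hek⟩ : ∃ e, e < 2 ∧ k + 1 = 507905 * K + e :=  -- binade 16
      ⟨k + 1 - 507905 * K, by omega, by omega⟩
    rcases Nat.mod_two_eq_zero_or_one e with hp | hp
    · refine value_step8 hq hR (n := (32768 * K + e) * 131072 + 71680) ?_ (by omega) ?_
      · rw [traj8N_T16 (by omega) (by omega), hek, fam8Z_B16 K e he, pairZ_even _ _ hp]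
        push_cast; omega
      · rw [traj8N_T16 (by omega) (by omega), rneSigMag_binade_step (j := 16) hM h2 (by norm_num)
          (by omega) (by norm_num)]
        simp [stepUp]; omega
    · refine value_step8 hq hR (n := (32768 * K + e) * 131072 + 65536) ?_ (by omega) ?_
      · rw [traj8N_T16 (by omega) (by omega), hek, fam8Z_B16 K e he, pairZ_odd _ _ hp]
        push_cast; omega
      · rw [traj8N_T16 (by omega) (by omega), rneSigMag_binade_step (j := 16) hM h2 (by norm_num)
          (by omega) (by norm_num)]
        simp [stepUp]; omega

/-- `ŝ₀ = 256` (for `K = 1` the first letter is `2^(m+1)` itself). [cell] -/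
theorem fam8_s0 : (seqSum φ (fam8 K) 0).toRat = traj8 K 0 := by
  obtain ⟨hK1, hpow, hpow1⟩ := pow_facts8 hM
  show (roundNE φ (fam8 K 0)).toRat = traj8 K 0
  unfold fam8 traj8
  rw [fam8Z_P (by omega), traj8N_P (by omega)]
  have hr : rneSigMag φ.manBits 65536 = 65536 := by
    rcases Nat.lt_or_ge 65536 (2 ^ (φ.manBits + 1)) with h | h
    · exact rneSigMag_of_lt h
    · have hK : K = 1 := by rw [hpow1] at h; omega
      subst hK
      have h' := rneSigMag_binade_step (t := 0) (r := 0) (j := 0) (u := 2) hM ⟨16384, rfl⟩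
        (by norm_num) (by norm_num) (by norm_num)
      simpa [stepUp] using h'
  have h := roundNE_grid8_nat hq hR (n := 65536) (by omega)
  rw [hr] at h
  push_cast at h ⊢
  simpa using h

/-- THE ACCUMULATOR FOLLOWS `traj8` ALONG THE WHOLE PREFIX. [cell] -/
theorem fam8_seqSum : ∀ k ≤ 507905 * K + 1, (seqSum φ (fam8 K) k).toRat = traj8 K k := by
  intro k hk
  have h := seqSum_orbitFn (α := φ) (fam8 K) 0 (507905 * K + 1) (fun j => fam8 K (j + 1)) (traj8 K)
    (fun j _ => by rw [Nat.zero_add]) (fam8_s0 hq hR hM)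
    (fun j hj => (traj8_step hq hR hM j hj).1) k hk
  rwa [Nat.zero_add] at h

/-- The prefix stays in range. [cell] -/
theorem fam8_inRange_prefix : InRange φ (fam8 K) (507905 * K + 1) := by
  obtain ⟨hK1, hpow, -⟩ := pow_facts8 hM
  refine ⟨?_, fun k hk => ?_⟩
  · unfold fam8; rw [fam8Z_P (by omega), abs_of_nonneg (by positivity)]
    exact le_trans (by norm_num) (grid8_le_maxRat hR (n := 65536) (by omega))
  · rw [fam8_seqSum hq hR hM k (le_of_lt hk)]
    exact (traj8_step hq hR hM k hk).2

end Steps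

end Summit.Ventures.CertifiedArithmetic.LowPrec.Gemm
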